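import Summits.AtomisticToContinuum.HydrodynamicLimit.Theses.ImplosionDichotomy
import Summits.AtomisticToContinuum.HydrodynamicLimit.Theorems.DenseExcursion.Negative.Dichotomy

/-!
# Route ImplosionDichotomy — `DiluteOfNotDenseExcursion` (item stmt-AtomisticToContinuum-14730)

`DiluteOfNotDenseExcursion := ¬ DenseExcursion → DiluteSelfConsistency` is the negative-side edge of the
dichotomy: refuting the rank-2 crux `DenseExcursion` PROVES the hypothesis `hD : DiluteSelfConsistency` of the
route's deciding theorem `closes`. The dichotomy `¬ DenseExcursion ↔ DiluteSelfConsistency` is already in the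
tree (`Theorems.not_denseExcursion_iff_diluteSelfConsistency`, file
`Theorems/DenseExcursion/Negative/Dichotomy.lean`: `←` pushes `¬` through `DiluteSelfConsistency` and transfers
the `t = 0` tie between flow families — it is flow-independent since `Φ 0 = id` Liouville-a.e. and the local
Gibbs law is absolutely continuous; `→` instantiates the `∀ Φ` of `DiluteSelfConsistency` with Alexander's flow
family below `σ < 1/2`). This file closes the item by the `mp` direction of that equivalence.
-/

namespace Summit.AtomisticToContinuum.HydrodynamicLimit.Theorems

open Summit.AtomisticToContinuum.HydrodynamicLimit.Theses in
/-- Item stmt-AtomisticToContinuum-14730 of route ImplosionDichotomy: `¬ DenseExcursion → DiluteSelfConsistency`.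
If no dense excursion exists (no profiles whose admissible classical hard-sphere-Euler solutions reach a fixed
packing `η` at arbitrarily small `σ`), then every such solution stays below every packing threshold for `σ`
small — the forward direction of the in-tree dichotomy `not_denseExcursion_iff_diluteSelfConsistency`. -/
theorem diluteOfNotDenseExcursion_proof :
    Summit.AtomisticToContinuum.HydrodynamicLimit.Theses.ImplosionDichotomy.DiluteOfNotDenseExcursion := by
  unfold ImplosionDichotomy.DiluteOfNotDenseExcursion
  intro h
  exact not_denseExcursion_iff_diluteSelfConsistency.mp h

end Summit.AtomisticToContinuum.HydrodynamicLimit.Theorems
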